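import Literature.AlgebraicGeometry.Kloosterman2023.CompleteIntersectionHodgeLoci
import HarnessLib

/-!
# The Hilbert function of a join algebraic cycle is a convolution (Duque Franco–Villaflor Loyola 2025, §6)

J. Duque Franco, R. Villaflor Loyola, *Periods of join algebraic cycles*, Ann. Sc. Norm. Super. Pisa Cl. Sci.
(2025), doi:10.2422/2036-2145.202409_029 = arXiv:2312.17222 [DuqueFrancoVillaflor2025Join]. Verbatim from the
held text (arXiv version, chunks p0003, p0006, p0017, p0018):

> **Theorem 1.1.** Let `Z₁ ∈ CH^{k/2}(X₁)` and `Z₂ ∈ CH^{(n−k−2)/2}(X₂)`, then `J(Z₁,Z₂) ∈ CH^{n/2}(X)`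
> satisfies `P_{J(Z₁,Z₂)} = P_{Z₁} · P_{Z₂}`. Furthermore, if `δ ∈ H^{n/2,n/2}(X,ℚ)_prim` then
> `R^{f+g,δ} = R^{f,[Z₁]} ⊗ R^{g,[Z₂]} ⟺ δ = c·[J(Z₁,Z₂)]_prim` for some `c ∈ ℚ^×`.

(here `X₁ = {f(x) = 0} ⊆ ℙ^{k+1}`, `X₂ = {g(y) = 0} ⊆ ℙ^{n−k−1}`, `X = {f(x)+g(y) = 0} ⊆ ℙ^{n+1}`, all smooth
of degree `d`; `J(Z₁,Z₂)` = closure of the union of the lines joining `Z₁` and `Z₂`; `R^{F,λ} = ℂ[x]/J^{F,λ}`,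
`J^{F,λ} := (J^F : P_λ)` the Artinian Gorenstein ideal of the Hodge cycle `λ`, Def. 2.2), and

> (2.3) `T_tV_λ = J^{F,λ}_d`. Where we have identified `T_tT ≃ ℂ[x₀,…,x_{n+1}]_d`.
>
> **Definition 6.1.** […] For every `λ ∈ H^{n/2,n/2}(X,ℚ)`, its associated Hilbert function
> `HF_λ : ℤ_{≥0} → ℤ_{≥0}` is the Hilbert function of its associated Artinian Gorenstein algebra `R^{F,λ}`.
>
> **Corollary 6.1.** In the same context of (Thm. 1.1) we have `HF_{[J(Z₁,Z₂)]} = HF_{[Z₁]} * HF_{[Z₂]}`, this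
> means that for all `k ≥ 0`, `HF_{[J(Z₁,Z₂)]}(k) = Σ_{p+q=k} HF_{[Z₁]}(p)·HF_{[Z₂]}(q)`.
> *Proof.* This follows from (Thm. 1.1). □
>
> **Example 6.1.** […] for one linear cycle in Fermat we get `HF_{[ℙ^{n/2}]} = φ^{*(n/2+1)}` where
> `φ : ℤ_{≥0} → ℤ_{≥0}` is the Hilbert function of a point in a `0`-dimensional Fermat variety,
> `φ(k) = 1` if `0 ≤ k ≤ d−2`, `0` otherwise. In other words `HF_{[ℙ^{n/2}]}(k)` counts the number of ways
> of writing `k` as an ordered sum of `n/2+1` numbers between `0` and `d−2`.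
>
> **Remark 7.1.** […] `HF_λ(d) = C(n/2+d, d) − (n/2+1)² = HF_{[ℙ^{n/2}]}(d)` […]
>
> **Remark 7.2.** […] More generally, for any algebraic cycle given as a cone `Z = J(pt, Z₂)` we can
> construct a fake version of `Z` if we replace the point by a `0`-dimensional fake linear cycle.

## What this file PROVES (the combinatorial / linear-algebra layer of §6–7; no periods, no new fact)
* `finrank_joinPiece`: for two `ℕ`-graded vector spaces with finite-dimensional pieces `A_p`, `B_q`, the
  degree-`k` piece `⊕_{p+q=k} A_p ⊗ B_q` of their tensor product has dimension the convolution `conv` of the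
  two Hilbert functions — the step "This follows from Thm. 1.1" in the proof of Cor. 6.1;
* `conv` is commutative and associative (it is the Cauchy product: `series_conv`), with unit `delta`;
* Ex. 6.1's `φ = pointHF d` equals the tree's Hilbert function of `ℂ[t]/(t^{d−1})`
  (`pointHF_eq_ciHilbert`), and the Hilbert function of a (monomial) complete intersection is the convolution
  of those of its factors (`ciHilbert_cons_eq_conv`, `ciHilbert_append`: the join of complete intersections,
  Rem. 6.1); hence `HF_{[ℙ^{n/2}]} = φ^{*(n/2+1)} = Kloosterman2023.ciHilbert (replicate (n/2+1) (d−1))`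
  (`linearCycleHF_eq_ciHilbert`);
* THE CONE IDENTITY (Rem. 7.2 + Cor. 6.1 + Ex. 6.1 + (2.3)): for a cone `Z = J(pt, Z₂)` over a cycle `Z₂` of a
  degree-`d` hypersurface two dimensions down, `HF_{[Z]}(k) = Σ_{a = k−d+2}^{k} HF_{[Z₂]}(a)`
  (`conv_pointHF`), in particular the codimension of the Zariski tangent space of `V_{[Z]}` is
  `HF_{[Z]}(d) = Σ_{a=2}^{d} HF_{[Z₂]}(a)` (`coneHF_self`) — valid for ANY function `HF_{[Z₂]}`;
* Rem. 7.1's number in closed form, for all `n` and `d ≥ 3`: `φ^{*(n/2+1)}(d) + (n/2+1)² = C(n/2+d, d)`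
  (`linearCycleHF_self`), i.e. the tree's `Kloosterman2023.linC a (k+1) d = C(k+d,d) − (k+1)²`
  (`linC_closed_form`); and the iterated cone reading `HF_{[ℙ^{k+1}]}(d) = Σ_{a=2}^{d} HF_{[ℙ^{k}]}(a)`
  (`linearCycleHF_succ_self`), with the printed low-degree instances by `decide`.

* (appended the same day) the linear-algebra step named in the cell's reading of Thm. 1.1 degree by degree —
  `rank(A ⊗ B) = rank A · rank B` [Bernstein, *Matrix Mathematics* (2009), Fact 7.4.24]: `finrank_range_map`
  (`finrank (range (f ⊗ g)) = finrank (range f) · finrank (range g)` over a field, via flatness), and its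
  graded sum `sum_finrank_range_map_eq_conv` (`Σ_{p+q=k} rank(P_p ⊗ Q_q) = (rank P * rank Q)(k)`): the rank of
  multiplication by `P_{Z₁}·P_{Z₂} = P_{Z₁} ⊗ P_{Z₂}` on `(R^f ⊗ R^g)_k = ⊕_{p+q=k} R^f_p ⊗ R^g_q` is the
  convolution of the two rank functions.
NOT formalised here: periods and residues (Thms. 1.1–1.3 themselves), the Artinian Gorenstein ideal of a Hodge
cycle, the identification (2.3). HONEST FRAMING (cell pub-hlocus): certified instances and evidence bearing on
the general Hodge conjecture; no claim.
-/

namespace Literature.AlgebraicGeometry.DuqueFrancoVillaflor2025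

open Finset
open Literature.AlgebraicGeometry.Kloosterman2023 (ciHilbert ciHilbert_cons ciHilbert_nil ciHilbert_one_cons linC)

/-! ## Hilbert functions as functions `ℕ → ℕ`; the convolution of Cor. 6.1 -/

/-- Cor. 6.1's product: `(HF₁ * HF₂)(k) = Σ_{p+q=k} HF₁(p)·HF₂(q)`, written as a list sum over `p = 0,…,k`
so that the kernel evaluates it. [cite: DuqueFrancoVillaflor2025Join, Cor. 6.1] -/
def conv (h₁ h₂ : ℕ → ℕ) (k : ℕ) : ℕ := ((List.range (k + 1)).map fun p => h₁ p * h₂ (k - p)).sum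

/-- List-sum over `List.range` as a `Finset.range` sum (private plumbing). [folklore] -/
private theorem list_range_map_sum (f : ℕ → ℕ) (n : ℕ) : ((List.range n).map f).sum = ∑ p ∈ range n, f p := by
  rw [← List.toFinset_range, List.sum_toFinset _ List.nodup_range]

/-- `(HF₁ * HF₂)(k) = Σ_{p ≤ k} HF₁(p)·HF₂(k−p)`. [cite: DuqueFrancoVillaflor2025Join, Cor. 6.1] -/
theorem conv_eq_sum_range (h₁ h₂ : ℕ → ℕ) (k : ℕ) :
    conv h₁ h₂ k = ∑ p ∈ range (k + 1), h₁ p * h₂ (k - p) := by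
  rw [conv, list_range_map_sum]

/-- `(HF₁ * HF₂)(k) = Σ_{p+q=k} HF₁(p)·HF₂(q)` exactly as printed. [cite: DuqueFrancoVillaflor2025Join, Cor. 6.1] -/
theorem conv_eq_sum_antidiagonal (h₁ h₂ : ℕ → ℕ) (k : ℕ) :
    conv h₁ h₂ k = ∑ pq ∈ antidiagonal k, h₁ pq.1 * h₂ pq.2 := by
  rw [conv_eq_sum_range, Finset.Nat.sum_antidiagonal_eq_sum_range_succ (fun p q => h₁ p * h₂ q)]

/-- The convolution is commutative. [cite: DuqueFrancoVillaflor2025Join, Cor. 6.1] -/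
theorem conv_comm (h₁ h₂ : ℕ → ℕ) : conv h₁ h₂ = conv h₂ h₁ := by
  funext k
  rw [conv_eq_sum_antidiagonal, conv_eq_sum_antidiagonal, ← Finset.Nat.sum_antidiagonal_swap]
  exact Finset.sum_congr rfl fun p _ => by rw [Prod.fst_swap, Prod.snd_swap, mul_comm]

/-- The generating series `Σ_k HF(k) X^k ∈ ℕ⟦X⟧` of a Hilbert function. [folklore] -/
noncomputable def series (h : ℕ → ℕ) : PowerSeries ℕ := PowerSeries.mk h

/-- The convolution is the Cauchy product of generating series. [cite: DuqueFrancoVillaflor2025Join, Cor. 6.1] -/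
theorem series_conv (h₁ h₂ : ℕ → ℕ) : series (conv h₁ h₂) = series h₁ * series h₂ := by
  ext k
  rw [PowerSeries.coeff_mul, series, PowerSeries.coeff_mk, conv_eq_sum_antidiagonal]
  simp [series]

/-- The convolution is associative (so iterated joins `J(Z₁,…,Z_r)` have a well-defined Hilbert function).
[cite: DuqueFrancoVillaflor2025Join, Cor. 6.1] -/
theorem conv_assoc (h₁ h₂ h₃ : ℕ → ℕ) : conv (conv h₁ h₂) h₃ = conv h₁ (conv h₂ h₃) := by
  funext k
  have h : series (conv (conv h₁ h₂) h₃) = series (conv h₁ (conv h₂ h₃)) := by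
    rw [series_conv, series_conv, series_conv, series_conv, mul_assoc]
  simpa [series] using PowerSeries.ext_iff.mp h k

/-- The Hilbert function of the ground field (no variables): `δ₀`, the unit of the convolution.
[cite: DuqueFrancoVillaflor2025Join, Cor. 6.1] -/
def delta (k : ℕ) : ℕ := if k = 0 then 1 else 0

/-- `δ₀` is the tree's `ciHilbert []`. [cite: Kloosterman2023, §2 eq. (1)] -/
theorem delta_eq_ciHilbert_nil : delta = ciHilbert [] := by
  funext k; rw [ciHilbert_nil]; rfl

/-- `δ₀ * HF = HF`. [cite: DuqueFrancoVillaflor2025Join, Cor. 6.1] -/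
theorem conv_delta_left (h : ℕ → ℕ) : conv delta h = h := by
  funext k
  rw [conv_eq_sum_range, Finset.sum_range_succ']
  simp [delta]

/-- `HF * δ₀ = HF`. [cite: DuqueFrancoVillaflor2025Join, Cor. 6.1] -/
theorem conv_delta_right (h : ℕ → ℕ) : conv h delta = h := by
  rw [conv_comm, conv_delta_left]

/-- Convolution powers `HF^{*j}` (`HF^{*0} = δ₀`), the Hilbert function of a `j`-fold iterated join.
[cite: DuqueFrancoVillaflor2025Join, Ex. 6.1] -/
def convPow (h : ℕ → ℕ) : ℕ → ℕ → ℕ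
  | 0 => delta
  | j + 1 => conv (convPow h j) h

/-- `HF^{*(j+1)} = HF^{*j} * HF`. [cite: DuqueFrancoVillaflor2025Join, Ex. 6.1] -/
theorem convPow_succ (h : ℕ → ℕ) (j : ℕ) : convPow h (j + 1) = conv (convPow h j) h := rfl

/-- `HF^{*1} = HF`. [cite: DuqueFrancoVillaflor2025Join, Ex. 6.1] -/
theorem convPow_one (h : ℕ → ℕ) : convPow h 1 = h := by
  rw [convPow_succ]; exact conv_delta_left h

/-! ## The proof of Cor. 6.1: the degree-`k` piece of a tensor product of graded spaces -/

/-- "This follows from Thm. 1.1": once `R^{f+g,[J(Z₁,Z₂)]} = R^{f,[Z₁]} ⊗ R^{g,[Z₂]}` as graded algebras, the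
degree-`k` piece is `⊕_{p+q=k} R^{f,[Z₁]}_p ⊗ R^{g,[Z₂]}_q`, whose dimension is the convolution of the two
Hilbert functions. Stated for arbitrary families of finite-dimensional spaces `A_p`, `B_q` over a field.
[cite: DuqueFrancoVillaflor2025Join, Cor. 6.1 (proof)] -/
theorem finrank_joinPiece {K : Type*} [Field K] (A B : ℕ → Type*)
    [∀ p, AddCommGroup (A p)] [∀ p, Module K (A p)] [∀ p, FiniteDimensional K (A p)]
    [∀ q, AddCommGroup (B q)] [∀ q, Module K (B q)] [∀ q, FiniteDimensional K (B q)] (k : ℕ) :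
    Module.finrank K (DirectSum ↥(antidiagonal k) fun pq => TensorProduct K (A pq.1.1) (B pq.1.2)) =
      conv (fun p => Module.finrank K (A p)) (fun q => Module.finrank K (B q)) k := by
  rw [Module.finrank_directSum, conv_eq_sum_antidiagonal, ← Finset.sum_coe_sort (antidiagonal k)]
  simp only [Module.finrank_tensorProduct]

/-- Codimension of a subspace = dimension of the quotient: with (2.3) `T_tV_λ = J^{F,λ}_d ⊆ ℂ[x]_d = T_tT`,
`codim_{T_tT} T_tV_λ = dim (ℂ[x]/J^{F,λ})_d = HF_λ(d)`. [cite: DuqueFrancoVillaflor2025Join, eq. (2.3) and Def. 6.1] -/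
theorem codim_eq_finrank_quotient {K V : Type*} [Field K] [AddCommGroup V] [Module K V]
    [FiniteDimensional K V] (W : Submodule K V) :
    Module.finrank K V - Module.finrank K W = Module.finrank K (V ⧸ W) := by
  have := Submodule.finrank_quotient_add_finrank W
  omega

/-! ## Ex. 6.1: the Hilbert function `φ` of a point of a `0`-dimensional degree-`d` hypersurface -/

/-- `φ(k) = 1` if `0 ≤ k ≤ d−2` and `0` otherwise (written `k + 2 ≤ d`): the Hilbert function of
`R^{F,[p]} = ℂ[x₀,x₁]/⟨x₀ − c x₁, x₀^{d−1}, x₁^{d−1}⟩ ≅ ℂ[t]/(t^{d−1})` for a point `p` of `{F = 0} ⊆ ℙ¹`.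
[cite: DuqueFrancoVillaflor2025Join, Ex. 6.1] -/
def pointHF (d k : ℕ) : ℕ := if k + 2 ≤ d then 1 else 0

/-- The tree's Hilbert function of one variable with exponent bound `a`: `h(ℂ[t]/(t^a); k) = [k < a]`.
[cite: Kloosterman2023, §2 eq. (1)] -/
theorem ciHilbert_singleton (a k : ℕ) : ciHilbert [a] k = if k < a then 1 else 0 := by
  rw [ciHilbert_cons, list_range_map_sum]
  simp only [ciHilbert_nil]
  have key : ∀ j ∈ range a, (if j ≤ k then (if k - j = 0 then 1 else 0) else 0) =
      (if k = j then 1 else 0 : ℕ) := by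
    intro j _
    split_ifs <;> omega
  rw [Finset.sum_congr rfl key, Finset.sum_ite_eq]
  simp [Finset.mem_range]

/-- `φ = ` the Hilbert function of `ℂ[t]/(t^{d−1})` (`Kloosterman2023.ciHilbert [d−1]`).
[cite: DuqueFrancoVillaflor2025Join, Ex. 6.1] -/
theorem pointHF_eq_ciHilbert (d : ℕ) : pointHF d = ciHilbert [d - 1] := by
  funext k
  rw [ciHilbert_singleton, pointHF]
  split_ifs <;> omega

/-! ## The cone identity: `HF_{[J(pt,Z₂)]}(k) = Σ_{a=k−d+2}^{k} HF_{[Z₂]}(a)` -/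

/-- For a cone `Z = J(pt, Z₂)` (Rem. 7.2) Cor. 6.1 and Ex. 6.1 give `HF_{[Z]} = HF_{[Z₂]} * φ`, i.e. a moving
window sum: `HF_{[Z]}(k) = Σ_{a = k+2−d}^{k} HF_{[Z₂]}(a)` — for ANY function `h = HF_{[Z₂]}`.
[cite: DuqueFrancoVillaflor2025Join, Cor. 6.1, Ex. 6.1, Rem. 7.2] -/
theorem conv_pointHF (h : ℕ → ℕ) (d k : ℕ) :
    conv h (pointHF d) k = ∑ a ∈ Icc (k + 2 - d) k, h a := by
  rw [conv_eq_sum_range]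
  have hIcc : Icc (k + 2 - d) k = (range (k + 1)).filter fun p => k + 2 - d ≤ p := by
    ext p
    simp only [Finset.mem_Icc, Finset.mem_filter, Finset.mem_range]
    omega
  rw [hIcc, Finset.sum_filter]
  refine Finset.sum_congr rfl fun p hp => ?_
  have hpk : p < k + 1 := Finset.mem_range.mp hp
  simp only [pointHF, mul_ite, mul_one, mul_zero]
  split_ifs <;> first | rfl | omega

/-- The same identity with the cut-off part moved to the other side (`d ≥ 1`):
`HF_{[J(pt,Z₂)]}(k) + Σ_{a < k+2−d} HF_{[Z₂]}(a) = Σ_{a ≤ k} HF_{[Z₂]}(a)`.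
[cite: DuqueFrancoVillaflor2025Join, Cor. 6.1, Ex. 6.1, Rem. 7.2] -/
theorem conv_pointHF_add (h : ℕ → ℕ) {d : ℕ} (hd : 1 ≤ d) (k : ℕ) :
    conv h (pointHF d) k + ∑ a ∈ range (k + 2 - d), h a = ∑ a ∈ range (k + 1), h a := by
  rw [conv_pointHF]
  have hIcc : Icc (k + 2 - d) k = (range (k + 1)).filter fun a => k + 2 - d ≤ a := by
    ext a
    simp only [Finset.mem_Icc, Finset.mem_filter, Finset.mem_range]
    omega
  have hlow : range (k + 2 - d) = (range (k + 1)).filter fun a => ¬ (k + 2 - d ≤ a) := by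
    ext a
    simp only [Finset.mem_filter, Finset.mem_range]
    omega
  rw [hIcc, hlow, Finset.sum_filter_add_sum_filter_not]

/-- The Hilbert function of a cone over `Z₂`: `HF_{[J(pt,Z₂)]} = HF_{[Z₂]} * φ_d`.
[cite: DuqueFrancoVillaflor2025Join, Rem. 7.2, Cor. 6.1] -/
def coneHF (h : ℕ → ℕ) (d : ℕ) : ℕ → ℕ := conv h (pointHF d)

/-- THE CONE IDENTITY in degree `d` (the degree of the Zariski tangent space, eq. (2.3)): the codimension of
`T_tV_{[J(pt,Z₂)]}` is `HF_{[J(pt,Z₂)]}(d) = Σ_{a=2}^{d} HF_{[Z₂]}(a)`.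
[cite: DuqueFrancoVillaflor2025Join, Cor. 6.1, Ex. 6.1, Rem. 7.2, eq. (2.3)] -/
theorem coneHF_self (h : ℕ → ℕ) (d : ℕ) : coneHF h d d = ∑ a ∈ Icc 2 d, h a := by
  rw [coneHF, conv_pointHF, Nat.add_sub_cancel_left]

/-- Below the window nothing is cut off: `HF_{[J(pt,Z₂)]}(k) = Σ_{a ≤ k} HF_{[Z₂]}(a)` for `k ≤ d−2`.
[cite: DuqueFrancoVillaflor2025Join, Cor. 6.1, Ex. 6.1] -/
theorem conv_pointHF_low (h : ℕ → ℕ) {d k : ℕ} (hk : k + 2 ≤ d) :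
    conv h (pointHF d) k = ∑ a ∈ range (k + 1), h a := by
  have e := conv_pointHF_add h (d := d) (by omega) k
  rw [show k + 2 - d = 0 by omega, Finset.sum_range_zero, add_zero] at e
  exact e

/-- In degree `d−1` exactly the constant term is cut off (`d = m+3 ≥ 3`).
[cite: DuqueFrancoVillaflor2025Join, Cor. 6.1, Ex. 6.1] -/
theorem conv_pointHF_pred (h : ℕ → ℕ) (m : ℕ) :
    conv h (pointHF (m + 3)) (m + 2) + h 0 = ∑ a ∈ range (m + 3), h a := by
  have e := conv_pointHF_add h (d := m + 3) (by omega) (m + 2)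
  rw [show m + 2 + 2 - (m + 3) = 1 by omega, Finset.sum_range_one] at e
  exact e

/-- In degree `d` exactly the terms of degree `0` and `1` are cut off (`d = m+3 ≥ 3`).
[cite: DuqueFrancoVillaflor2025Join, Cor. 6.1, Ex. 6.1] -/
theorem conv_pointHF_top (h : ℕ → ℕ) (m : ℕ) :
    conv h (pointHF (m + 3)) (m + 3) + h 0 + h 1 = ∑ a ∈ range (m + 4), h a := by
  have e := conv_pointHF_add h (d := m + 3) (by omega) (m + 3)
  rw [show m + 3 + 2 - (m + 3) = 2 by omega, Finset.sum_range_succ, Finset.sum_range_one] at e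
  have e' : ∑ a ∈ range (m + 4), h a = ∑ a ∈ range (m + 3 + 1), h a := rfl
  omega

/-! ## Joins of complete intersections (Rem. 6.1) and Ex. 6.1: `HF_{[ℙ^{n/2}]} = φ^{*(n/2+1)}` -/

/-- The Hilbert function of a monomial complete intersection peels off one generator as a convolution factor:
`h(t^{a}, rest) = h(ℂ[t]/(t^a)) * h(rest)` — the join with a `0`-dimensional complete intersection.
[cite: DuqueFrancoVillaflor2025Join, Cor. 6.1, Rem. 6.1] -/
theorem ciHilbert_cons_eq_conv (a : ℕ) (l : List ℕ) :
    ciHilbert (a :: l) = conv (ciHilbert [a]) (ciHilbert l) := by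
  funext k
  rw [ciHilbert_cons a l k, list_range_map_sum, conv_eq_sum_range]
  simp only [ciHilbert_singleton, ite_mul, one_mul, zero_mul]
  rw [← Finset.sum_filter, ← Finset.sum_filter]
  congr 1
  ext j
  simp only [Finset.mem_filter, Finset.mem_range]
  omega

/-- The Hilbert function of a join of (monomial) complete intersections is the convolution of the two
Hilbert functions: `h(l₁ ++ l₂) = h(l₁) * h(l₂)`. [cite: DuqueFrancoVillaflor2025Join, Cor. 6.1, Rem. 6.1] -/
theorem ciHilbert_append (l₁ l₂ : List ℕ) :
    ciHilbert (l₁ ++ l₂) = conv (ciHilbert l₁) (ciHilbert l₂) := by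
  induction l₁ with
  | nil => rw [List.nil_append, ← delta_eq_ciHilbert_nil, conv_delta_left]
  | cons a l₁ ih =>
    rw [List.cons_append, ciHilbert_cons_eq_conv a (l₁ ++ l₂), ih, ciHilbert_cons_eq_conv a l₁, conv_assoc]

/-- Ex. 6.1: the Hilbert function of a linear cycle `ℙ^{n/2}` of the Fermat variety `X^n_d` (Artinian Gorenstein
ideal `⟨x₀−c₀x₁, …, x_n − c_{n/2}x_{n+1}, x₀^{d−1}, …, x_{n+1}^{d−1}⟩`, eq. (7.2)) is `φ^{*(n/2+1)}`; we index by
`j = n/2 + 1`, the number of factors of the iterated join `J(p¹,…,p^{j})`.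
[cite: DuqueFrancoVillaflor2025Join, Ex. 6.1] -/
def linearCycleHF (j d : ℕ) : ℕ → ℕ := convPow (pointHF d) j

/-- `φ^{*j}` is the tree's Hilbert function of `ℂ[t₁,…,t_j]/(t₁^{d−1},…,t_j^{d−1})` (the quotient by
eq. (7.2)'s ideal after eliminating the linear forms). [cite: DuqueFrancoVillaflor2025Join, Ex. 6.1, eq. (7.2)] -/
theorem linearCycleHF_eq_ciHilbert (j d : ℕ) :
    linearCycleHF j d = ciHilbert (List.replicate j (d - 1)) := by
  induction j with
  | zero => exact delta_eq_ciHilbert_nil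
  | succ j ih =>
    rw [linearCycleHF, convPow_succ, ← linearCycleHF, ih, List.replicate_succ,
      ciHilbert_cons_eq_conv (d - 1) (List.replicate j (d - 1)), ← pointHF_eq_ciHilbert, conv_comm]

/-- … and with the `n/2+1` linear forms kept (the tree's `linC a b d = C_{1^a,(d−1)^b}` in degree `d`):
`linC a j d = φ^{*j}(d)`. [cite: DuqueFrancoVillaflor2025Join, Ex. 6.1, eq. (7.2)] [cite: Movasati2016Periods, Thm. 13] -/
theorem linC_eq_linearCycleHF (a j d : ℕ) : linC a j d = linearCycleHF j d d := by
  rw [linC, linearCycleHF_eq_ciHilbert]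
  induction a with
  | zero => rfl
  | succ a ih => rw [List.replicate_succ, List.cons_append, ciHilbert_one_cons, ih]

/-- The iterated-cone reading of Ex. 6.1: `ℙ^{k+1} ⊂ X^{2k+2}_d` is the cone `J(pt, ℙ^{k})` over a linear cycle
two dimensions down, so `HF_{[ℙ^{k+1}]}(d) = Σ_{a=2}^{d} HF_{[ℙ^{k}]}(a)`.
[cite: DuqueFrancoVillaflor2025Join, Ex. 6.1, Rem. 7.2] -/
theorem linearCycleHF_succ_self (j d : ℕ) :
    linearCycleHF (j + 1) d d = ∑ a ∈ Icc 2 d, linearCycleHF j d a := by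
  have e := coneHF_self (linearCycleHF j d) d
  rw [coneHF] at e
  exact e

/-! ## Rem. 7.1's number in closed form: `φ^{*(n/2+1)}(d) = C(n/2+d, d) − (n/2+1)²` for `d ≥ 3` -/

/-- The three values of `φ_d^{*(j+1)}` that the window recursion needs, `d = m + 3`:
in degrees `s ≤ d−2` the unrestricted count `C(s+j, j)`; in degree `d−1`, `C(d−1+j, j) − (j+1)`;
in degree `d`, `C(d+j, j) − (j+1)²` (Ex. 6.1: ordered sums of `j+1` numbers in `[0, d−2]`).
[cite: DuqueFrancoVillaflor2025Join, Ex. 6.1, Rem. 7.1] -/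
theorem linearCycleHF_values (m j : ℕ) :
    (∀ s, s ≤ m + 1 → linearCycleHF (j + 1) (m + 3) s = (s + j).choose j) ∧
    linearCycleHF (j + 1) (m + 3) (m + 2) + (j + 1) = (m + 2 + j).choose j ∧
    linearCycleHF (j + 1) (m + 3) (m + 3) + (j + 1) ^ 2 = (m + 3 + j).choose j := by
  induction j with
  | zero =>
    refine ⟨fun s hs => ?_, ?_, ?_⟩
    · have hc : s + 2 ≤ m + 3 := by omega
      simp [linearCycleHF, convPow_one, pointHF, hc]
    · have hc : ¬ (m + 2 + 2 ≤ m + 3) := by omega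
      simp [linearCycleHF, convPow_one, pointHF, hc]
    · have hc : ¬ (m + 3 + 2 ≤ m + 3) := by omega
      simp [linearCycleHF, convPow_one, pointHF, hc]
  | succ j ih =>
    obtain ⟨hlow, hpred, htop⟩ := ih
    have hrec : linearCycleHF (j + 1 + 1) (m + 3) =
        conv (linearCycleHF (j + 1) (m + 3)) (pointHF (m + 3)) := rfl
    -- prefix sums in the unrestricted range: the hockey-stick identity
    have hprefix : ∀ t, t ≤ m + 1 →
        ∑ a ∈ range (t + 1), linearCycleHF (j + 1) (m + 3) a = (t + j + 1).choose (j + 1) := by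
      intro t ht
      rw [← Nat.sum_range_add_choose t j]
      exact Finset.sum_congr rfl fun a ha =>
        hlow a (by have := Finset.mem_range.mp ha; omega)
    have h0 : linearCycleHF (j + 1) (m + 3) 0 = 1 := by
      rw [hlow 0 (by omega), Nat.zero_add, Nat.choose_self]
    have h1 : linearCycleHF (j + 1) (m + 3) 1 = j + 1 := by
      rw [hlow 1 (by omega), Nat.add_comm, Nat.choose_succ_self_right]
    refine ⟨fun s hs => ?_, ?_, ?_⟩
    · rw [show s + (j + 1) = s + j + 1 from (Nat.add_assoc _ _ _).symm, hrec,
        conv_pointHF_low (d := m + 3) (k := s) _ (by omega), hprefix s hs]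
    · have key := conv_pointHF_pred (linearCycleHF (j + 1) (m + 3)) m
      rw [Finset.sum_range_succ, hprefix (m + 1) le_rfl] at key
      have pascal : (m + 2 + (j + 1)).choose (j + 1) =
          (m + 1 + j + 1).choose (j + 1) + (m + 2 + j).choose j := by
        rw [show m + 2 + (j + 1) = (m + 1 + j + 1) + 1 by omega, Nat.choose_succ_succ' (m + 1 + j + 1) j,
          show m + 2 + j = m + 1 + j + 1 by omega]
        omega
      rw [hrec]
      omega
    · have key := conv_pointHF_top (linearCycleHF (j + 1) (m + 3)) m
      rw [Finset.sum_range_succ, Finset.sum_range_succ, hprefix (m + 1) le_rfl] at key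
      have pascal₁ : (m + 3 + j).choose (j + 1) =
          (m + 1 + j + 1).choose (j + 1) + (m + 2 + j).choose j := by
        rw [show m + 3 + j = (m + 1 + j + 1) + 1 by omega, Nat.choose_succ_succ' (m + 1 + j + 1) j,
          show m + 2 + j = m + 1 + j + 1 by omega]
        omega
      have pascal₂ : (m + 3 + (j + 1)).choose (j + 1) =
          (m + 3 + j).choose j + (m + 3 + j).choose (j + 1) := by
        rw [show m + 3 + (j + 1) = (m + 3 + j) + 1 by omega, Nat.choose_succ_succ' (m + 3 + j) j]
      have sq : (j + 1 + 1) ^ 2 = (j + 1) ^ 2 + 2 * (j + 1) + 1 := by ring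
      rw [hrec]
      omega

/-- Rem. 7.1 / Ex. 6.1 in closed form, all `k = n/2` and `d ≥ 3`:
`HF_{[ℙ^{k}]}(d) + (k+1)² = C(k+d, k)`, i.e. the codimension of the Zariski tangent space of the Hodge locus
of a linear cycle is `C(n/2+d, d) − (n/2+1)²`. [cite: DuqueFrancoVillaflor2025Join, Rem. 7.1, Ex. 6.1] -/
theorem linearCycleHF_self (k d : ℕ) (hd : 3 ≤ d) :
    linearCycleHF (k + 1) d d + (k + 1) ^ 2 = (k + d).choose k := by
  obtain ⟨m, rfl⟩ : ∃ m, d = m + 3 := ⟨d - 3, by omega⟩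
  rw [(linearCycleHF_values m k).2.2, show m + 3 + k = k + (m + 3) by omega]

/-- The same number in the tree's vocabulary: `C_{1^a,(d−1)^{k+1}}` in degree `d` (Movasati's Thm. 13 count,
the tree's `Kloosterman2023.linC`) is `C(k+d, d) − (k+1)²` for every `d ≥ 3`.
[cite: DuqueFrancoVillaflor2025Join, Rem. 7.1] [cite: Movasati2016Periods, Thm. 13] -/
theorem linC_closed_form (a k d : ℕ) (hd : 3 ≤ d) : linC a (k + 1) d + (k + 1) ^ 2 = (k + d).choose d := by
  rw [linC_eq_linearCycleHF, linearCycleHF_self k d hd, Nat.choose_symm_add]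

/-- Printed low-degree instances of Ex. 6.1 read as iterated cones, degree `d = 4` (`φ = 1` on `[0,2]`):
`HF_{[pt]}` on `[2,4]` is `1,0,0`; `HF_{[ℙ¹ ⊂ X²₄]}` is `3,2,1` there (Noether–Lefschetz codimension `1`);
`HF_{[ℙ² ⊂ X⁴₄]}(2..4) = 6,7,6` with `HF(4) = 3+2+1 = 6 = C(6,4) − 9`; `HF_{[ℙ³ ⊂ X⁶₄]}(4) = 6+7+6 = 19
= C(7,4) − 16`; `HF_{[ℙ⁴ ⊂ X⁸₄]}(4) = 10+16+19 = 45 = C(8,4) − 25`.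
[cite: DuqueFrancoVillaflor2025Join, Ex. 6.1, Rem. 7.1] -/
theorem linearCycleHF_quartic_table :
    (linearCycleHF 1 4 2 = 1 ∧ linearCycleHF 1 4 3 = 0 ∧ linearCycleHF 1 4 4 = 0) ∧
    (linearCycleHF 2 4 2 = 3 ∧ linearCycleHF 2 4 3 = 2 ∧ linearCycleHF 2 4 4 = 1) ∧
    (linearCycleHF 3 4 2 = 6 ∧ linearCycleHF 3 4 3 = 7 ∧ linearCycleHF 3 4 4 = 6) ∧
    (linearCycleHF 4 4 2 = 10 ∧ linearCycleHF 4 4 3 = 16 ∧ linearCycleHF 4 4 4 = 19) ∧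
    linearCycleHF 5 4 4 = 45 := by
  decide

/-- The same for the cubic (`φ = 1` on `[0,1]`, window `[2,3]`): `HF_{[ℙ^k ⊂ X^{2k}_3]}(2), (3)` for
`k = 1,…,5` are `(1,0), (3,1), (6,4), (10,10), (15,20)` — each `HF(3)` is the sum of the previous pair, and
`0, 1, 4, 10, 20 = C(k+3,3) − (k+1)²`.
[cite: DuqueFrancoVillaflor2025Join, Ex. 6.1, Rem. 7.1] -/
theorem linearCycleHF_cubic_table :
    (linearCycleHF 2 3 2 = 1 ∧ linearCycleHF 2 3 3 = 0) ∧ (linearCycleHF 3 3 2 = 3 ∧ linearCycleHF 3 3 3 = 1) ∧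
    (linearCycleHF 4 3 2 = 6 ∧ linearCycleHF 4 3 3 = 4) ∧ (linearCycleHF 5 3 2 = 10 ∧ linearCycleHF 5 3 3 = 10) ∧
    (linearCycleHF 6 3 2 = 15 ∧ linearCycleHF 6 3 3 = 20) := by
  decide

/-! ## Appendix: the rank of a tensor product of linear maps (`rank(A ⊗ B) = rank A · rank B`) -/

/-- "Let `A ∈ 𝔽^{n×m}` and `B ∈ 𝔽^{l×k}`. Then `rank(A ⊗ B) = (rank A)(rank B) = rank(B ⊗ A)`." For linear maps of
vector spaces over a field: `dim range(f ⊗ g) = dim range f · dim range g` (the range of `f ⊗ g` is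
`range f ⊗ range g`, embedded by flatness). This is the step that turns Thm. 1.1's `P_{J(Z₁,Z₂)} = P_{Z₁}·P_{Z₂}`
on `R^{f+g} = R^f ⊗ R^g` into Cor. 6.1 degree by degree. [cite: Bernstein2009, Fact 7.4.24]
[cite: DuqueFrancoVillaflor2025Join, Thm. 1.1 and Cor. 6.1] -/
theorem finrank_range_map {K M N P Q : Type*} [Field K] [AddCommGroup M] [Module K M] [AddCommGroup N]
    [Module K N] [AddCommGroup P] [Module K P] [AddCommGroup Q] [Module K Q]
    (f : M →ₗ[K] P) (g : N →ₗ[K] Q) :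
    Module.finrank K (LinearMap.range (TensorProduct.map f g)) =
      Module.finrank K (LinearMap.range f) * Module.finrank K (LinearMap.range g) := by
  rw [TensorProduct.range_map, ← TensorProduct.range_mapIncl,
    LinearMap.finrank_range_of_inj (Module.Flat.tensorProduct_mapIncl_injective_of_right _ _),
    Module.finrank_tensorProduct]

/-- The graded form used for joins: for families of linear maps `P_p : A_p → A'_p`, `Q_q : B_q → B'_q` (e.g. the
multiplications by `P_{Z₁}` on `R^f_p` and by `P_{Z₂}` on `R^g_q`), the total rank of `⊕_{p+q=k} P_p ⊗ Q_q` is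
the convolution of the two rank functions: `Σ_{p+q=k} rank(P_p ⊗ Q_q) = ((rank P) * (rank Q))(k)`.
[cite: Bernstein2009, Fact 7.4.24] [cite: DuqueFrancoVillaflor2025Join, Cor. 6.1] -/
theorem sum_finrank_range_map_eq_conv {K : Type*} [Field K] (A A' B B' : ℕ → Type*)
    [∀ p, AddCommGroup (A p)] [∀ p, Module K (A p)] [∀ p, AddCommGroup (A' p)] [∀ p, Module K (A' p)]
    [∀ q, AddCommGroup (B q)] [∀ q, Module K (B q)] [∀ q, AddCommGroup (B' q)] [∀ q, Module K (B' q)]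
    (P : ∀ p, A p →ₗ[K] A' p) (Q : ∀ q, B q →ₗ[K] B' q) (k : ℕ) :
    ∑ pq ∈ antidiagonal k, Module.finrank K (LinearMap.range (TensorProduct.map (P pq.1) (Q pq.2))) =
      conv (fun p => Module.finrank K (LinearMap.range (P p)))
        (fun q => Module.finrank K (LinearMap.range (Q q))) k := by
  rw [conv_eq_sum_antidiagonal]
  exact Finset.sum_congr rfl fun pq _ => finrank_range_map (P pq.1) (Q pq.2)

end Literature.AlgebraicGeometry.DuqueFrancoVillaflor2025
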